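import Mathlib
import HarnessLib
import Summits.NavierStokesRegularity.NavierStokesRegularity.Theorems.PoloidalWindowDoorPoloidalWindowRigidityPairingCollapse

/-!
# Route `PoloidalWindowDoor`, crux `PoloidalWindowRigidity` (stmt-19708), LINE 9 `sonic_cut` B1 `stub_balanceDatum` (third clause): the Riesz mass
# against an ARBITRARY `C²` weight supported in `B̄(c,2R)` with `‖D²χ‖ ≤ R⁻²` is bounded by `R⁻² ∫_{B̄(c,2R)} |v|²`

Seat ns-poloidal-K2-p2 g10 (LEAD-lineage on 19708; file `--supports`).  B1 of LINE 9 asks for bounds of the three null-Lagrangian masses against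
general weights `χ ∈ C²`, `χ = 0` off `B̄(c,2R)`, `‖iteratedFDeriv ℝ 2 χ‖ ≤ R⁻²`, at every centre `c`.  This file does the `e = tr((Dv)²)` clause's
calculus once and for all: from the landed null-Lagrangian identity `∫ χ·tr((Du)²) = ∫ ⟪u, D(∇χ) u⟫`
(`…RieszCollapse.integral_mul_traceSq_eq_integral_hessian`, p650966) and the pointwise bound `‖D(∇χ)(x) w‖ ≤ ‖iteratedFDeriv ℝ 2 χ x‖ ‖w‖`
(`norm_fderiv_gradient_apply_le`), for every `C²` divergence-free `u`:

  `|∫ χ · Σᵢ ⟪eᵢ, Du(Du eᵢ)⟫| ≤ R⁻² ∫_{B̄(c,2R)} |u|²`   (`abs_integral_weight_mul_traceSq_le`).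

The class version (energy `∫_{B̄(c,2R)}|v(s)|² ≤ min(3KR, 8V₁C²R³/(−s))` by S1 and the rate, interpolated to B1's typed rate `R^{−1/2}(−s)^{−1/4}`)
and the `Q₃`/`det` clauses (via `…HorizontalDet.integral_mul_jacobian_eq`) are left to the hand that lands B1 (recipe: HOME mirror
`ns-poloidal-K2-p2/g10/T1B1-recipe.md`).

WHAT THIS IS NOT: calculus only; no statement about Navier–Stokes (bears_on LADDER-NS N0 via crux 19708, LINE 9 B1). [folklore]
-/

noncomputable section

-- the summit and its single sub-problem share the name (CONVENTIONS §1), as in every Theorems file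
set_option linter.dupNamespace false

namespace Summit.NavierStokesRegularity.NavierStokesRegularity.Theorems.PoloidalWindowDoorPoloidalWindowRigidityWeightTrace

open MeasureTheory Set Function Filter Topology Metric InnerProductSpace
open scoped RealInnerProductSpace
open Literature.Analysis Literature.Analysis.FluidPDE
open Summit.NavierStokesRegularity.NavierStokesRegularity.Theorems.PoloidalWindowDoorPoloidalWindowRigidityRieszCollapse
open Summit.NavierStokesRegularity.NavierStokesRegularity.Theorems.PoloidalWindowDoorPoloidalWindowRigidityPairingCollapse

/-! ### Second derivatives: operator norm of `D(∇χ)` against `‖iteratedFDeriv ℝ 2 χ‖` -/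

/-- `∂_q∂_p χ(x) = (iteratedFDeriv ℝ 2 χ x) ![q, p]`. [folklore] -/
theorem fderiv_fderiv_apply_eq_iteratedFDeriv {χ : EuclideanSpace ℝ (Fin 3) → ℝ} (hχ : ContDiff ℝ 2 χ) (x p q : EuclideanSpace ℝ (Fin 3)) :
    fderiv ℝ (fun y => fderiv ℝ χ y p) x q = iteratedFDeriv ℝ 2 χ x ![q, p] := by
  have hd : DifferentiableAt ℝ (fderiv ℝ χ) x := ((hχ.fderiv_right (m := 1) le_rfl).differentiable one_ne_zero) x
  rw [iteratedFDeriv_two_apply, fderiv_clm_apply hd (differentiableAt_const p)]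
  simp

/-- `|∂_q∂_p χ(x)| ≤ ‖iteratedFDeriv ℝ 2 χ x‖ ‖q‖ ‖p‖`. [folklore] -/
theorem abs_fderiv_fderiv_apply_le {χ : EuclideanSpace ℝ (Fin 3) → ℝ} (hχ : ContDiff ℝ 2 χ) (x p q : EuclideanSpace ℝ (Fin 3)) :
    |fderiv ℝ (fun y => fderiv ℝ χ y p) x q| ≤ ‖iteratedFDeriv ℝ 2 χ x‖ * ‖q‖ * ‖p‖ := by
  rw [fderiv_fderiv_apply_eq_iteratedFDeriv hχ, ← Real.norm_eq_abs]
  refine ((iteratedFDeriv ℝ 2 χ x).le_opNorm _).trans (le_of_eq ?_)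
  simp [Fin.prod_univ_two, mul_assoc]

/-- **`‖D(∇χ)(x) w‖ ≤ ‖iteratedFDeriv ℝ 2 χ x‖ ‖w‖`** for `χ ∈ C²`. [folklore] -/
theorem norm_fderiv_gradient_apply_le {χ : EuclideanSpace ℝ (Fin 3) → ℝ} (hχ : ContDiff ℝ 2 χ) (x w : EuclideanSpace ℝ (Fin 3)) :
    ‖fderiv ℝ (gradient χ) x w‖ ≤ ‖iteratedFDeriv ℝ 2 χ x‖ * ‖w‖ := by
  set z := fderiv ℝ (gradient χ) x w with hz
  have hkey : ‖z‖ * ‖z‖ ≤ ‖iteratedFDeriv ℝ 2 χ x‖ * ‖w‖ * ‖z‖ := by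
    have h1 : ⟪z, z⟫ = fderiv ℝ (fun y => fderiv ℝ χ y z) x w := by rw [hz, fderiv_fderiv_apply_eq_inner hχ]
    have h2 := abs_fderiv_fderiv_apply_le hχ x z w
    rw [← h1, real_inner_self_eq_norm_sq, abs_of_nonneg (sq_nonneg _), sq] at h2
    exact h2
  by_cases h0 : ‖z‖ = 0
  · rw [h0]; positivity
  · exact le_of_mul_le_mul_right hkey (lt_of_le_of_ne (norm_nonneg _) (Ne.symm h0))

/-! ### The weighted Riesz mass -/

/-- **`|∫ χ·tr((Du)²)| ≤ R⁻² ∫_{B̄(c,2R)} |u|²`** for a `C²` divergence-free field `u` and a `C²` weight `χ` vanishing where `‖y − c‖ ≥ 2R` with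
`‖iteratedFDeriv ℝ 2 χ‖ ≤ R⁻²`. [folklore] -/
theorem abs_integral_weight_mul_traceSq_le {u : EuclideanSpace ℝ (Fin 3) → EuclideanSpace ℝ (Fin 3)} (hu : ContDiff ℝ 2 u)
    (hdiv : VectorCalculus.IsDivFree u) {χ : EuclideanSpace ℝ (Fin 3) → ℝ} (hχ : ContDiff ℝ 2 χ) {c : EuclideanSpace ℝ (Fin 3)} {R : ℝ}
    (hsupp : ∀ y, 2 * R ≤ ‖y - c‖ → χ y = 0) (hD2 : ∀ y, ‖iteratedFDeriv ℝ 2 χ y‖ ≤ 1 / R ^ 2) :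
    |∫ x, χ x * ∑ i : Fin 3, ⟪(EuclideanSpace.single i (1 : ℝ) : EuclideanSpace ℝ (Fin 3)), fderiv ℝ u x (fderiv ℝ u x (EuclideanSpace.single i (1 : ℝ)))⟫| ≤
      1 / R ^ 2 * ∫ x in closedBall c (2 * R), ‖u x‖ ^ 2 := by
  -- compact support of the weight
  have hχc : HasCompactSupport χ := by
    refine HasCompactSupport.intro (isCompact_closedBall c (2 * R)) fun y hy => hsupp y ?_
    rw [mem_closedBall, dist_eq_norm, not_le] at hy
    exact hy.le
  rw [integral_mul_traceSq_eq_integral_hessian hu hdiv hχ hχc]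
  set B : Set (EuclideanSpace ℝ (Fin 3)) := closedBall c (2 * R) with hB
  -- the Hessian of `χ` vanishes off `B̄(c,2R)`
  have hzero : ∀ x ∉ B, ⟪u x, fderiv ℝ (gradient χ) x (u x)⟫ = 0 := by
    intro x hx
    have hxU : x ∈ {y : EuclideanSpace ℝ (Fin 3) | 2 * R < ‖y - c‖} := by
      rw [hB, mem_closedBall, dist_eq_norm, not_le] at hx; exact hx
    have hU : IsOpen {y : EuclideanSpace ℝ (Fin 3) | 2 * R < ‖y - c‖} :=
      isOpen_lt continuous_const (continuous_id.sub continuous_const).norm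
    -- `χ ≡ 0` on the open set `U`, hence `∇χ ≡ 0` there
    have hgradU : ∀ y ∈ {y : EuclideanSpace ℝ (Fin 3) | 2 * R < ‖y - c‖}, gradient χ y = 0 := by
      intro y hy
      have hev : χ =ᶠ[𝓝 y] fun _ => 0 := by
        filter_upwards [hU.mem_nhds hy] with y' hy'
        exact hsupp y' (le_of_lt hy')
      simp only [gradient, hev.fderiv_eq, fderiv_fun_const, Pi.zero_apply, map_zero]
    have hev2 : gradient χ =ᶠ[𝓝 x] fun _ => 0 := by
      filter_upwards [hU.mem_nhds hxU] with y hy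
      exact hgradU y hy
    rw [hev2.fderiv_eq]
    simp
  rw [← setIntegral_eq_integral_of_forall_compl_eq_zero hzero]
  -- pointwise bound on `B̄(c,2R)`
  have hpt : ∀ x ∈ B, ‖⟪u x, fderiv ℝ (gradient χ) x (u x)⟫‖ ≤ 1 / R ^ 2 * ‖u x‖ ^ 2 := by
    intro x _
    rw [Real.norm_eq_abs]
    calc |⟪u x, fderiv ℝ (gradient χ) x (u x)⟫| ≤ ‖u x‖ * ‖fderiv ℝ (gradient χ) x (u x)‖ := abs_real_inner_le_norm _ _
      _ ≤ ‖u x‖ * (‖iteratedFDeriv ℝ 2 χ x‖ * ‖u x‖) := by gcongr; exact norm_fderiv_gradient_apply_le hχ x (u x)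
      _ ≤ ‖u x‖ * (1 / R ^ 2 * ‖u x‖) := by gcongr; exact hD2 x
      _ = 1 / R ^ 2 * ‖u x‖ ^ 2 := by ring
  have huc : Continuous u := hu.continuous
  have hg1 : ContDiff ℝ 1 (gradient χ) :=
    (InnerProductSpace.toDual ℝ (EuclideanSpace ℝ (Fin 3))).symm.contDiff.comp (hχ.fderiv_right (m := 1) le_rfl)
  have hIi : IntegrableOn (fun x => ⟪u x, fderiv ℝ (gradient χ) x (u x)⟫) B :=
    (huc.inner ((hg1.continuous_fderiv one_ne_zero).clm_apply huc)).continuousOn.integrableOn_compact (isCompact_closedBall _ _)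
  have hint : IntegrableOn (fun x => ‖u x‖ ^ 2) B := (huc.norm.pow 2).continuousOn.integrableOn_compact (isCompact_closedBall _ _)
  calc |∫ x in B, ⟪u x, fderiv ℝ (gradient χ) x (u x)⟫|
      ≤ ∫ x in B, 1 / R ^ 2 * ‖u x‖ ^ 2 := by
        rw [← Real.norm_eq_abs]
        exact (norm_integral_le_integral_norm _).trans (setIntegral_mono_on hIi.norm (hint.const_mul _) measurableSet_closedBall hpt)
    _ = 1 / R ^ 2 * ∫ x in B, ‖u x‖ ^ 2 := integral_const_mul _ _

end Summit.NavierStokesRegularity.NavierStokesRegularity.Theorems.PoloidalWindowDoorPoloidalWindowRigidityWeightTrace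

end
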